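import Literature.AlgebraicGeometry.Resolution.KollarMaxContactHypersurfaceChoice
import HarnessLib

/-!
# The hypersurface order reduction functor in dimension `0` (Kollár 2007, 3.70 with 3.104)

Topic: `Literature/AlgebraicGeometry/Resolution`. On the line discharging the named fact
`Kollar2007Thm3_103` (`KollarBlowupSequenceFunctors.lean`; J. Kollár, *Lectures on Resolution of
Singularities*, 2007). The tree reduces Thm. 3.103 to the existence, in EVERY dimension `n`, of a
hypersurface order reduction functor (`Kollar2007Thm3_103_of_hypersurfaceFunctor`,
`KollarMaxContactHypersurfaceChoice.lean`: `∀ n, (∀ n' < n, MarkedOrderReductionInDim n') →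
∀ m ≥ 1, ∃ B : HypersurfaceFunctor n m, IsHypersurfaceOrderReduction n m B`). In positive
dimension this is 3.104; in dimension `0` ("We can start the induction with the case
`dim X = 0`", 3.70, p. 150 of the held copy; `Kollar2007.orderReductionInDim_zero`) every
cosupport is empty (`Triple.support_marked_eq_empty`: the local rings are fields and `I ≠ 0`), so
the EMPTY blow-up sequence serves, and its five clauses are checked here — the hypersurfaces
required "upstairs" by the clauses are the empty hypersurface `𝒪_X(-∅) = 𝒪_X`:

* `Kollar2007.MaxContactHypersurface.top` — the empty hypersurface of maximal contact (on any
  triple);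
* **`Kollar2007.exists_isHypersurfaceOrderReduction_zero`** — `∃ B : HypersurfaceFunctor 0 m,
  IsHypersurfaceOrderReduction 0 m B` for every `m ≥ 1` (`B := ∅`).

## Sources

* J. Kollár, *Lectures on Resolution of Singularities*, Ann. of Math. Stud. 166, PUP 2007:
  3.70 (p. 150), 3.104 (pp. 172–173) of the held copy. [Kollar2007]
-/

noncomputable section

open CategoryTheory CategoryTheory.Limits AlgebraicGeometry TopologicalSpace IsLocalRing

namespace Literature.AlgebraicGeometry.Resolution

universe u

namespace Kollar2007

variable {k : Type u} [Field k] {n : ℕ}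

/-- **The empty hypersurface `𝒪_X(-∅) = 𝒪_X`** is (vacuously) a hypersurface of maximal contact
on every triple: `𝒪_X ⊆ MC(I)` fails in general, so this is only available where `MC(I) = 𝒪_X`,
e.g. when the cosupport is empty — we record the general constructor from that hypothesis.
[cite: Kollar2007, 3.104 (p. 172): "it may hold globally as well"] -/
def MaxContactHypersurface.ofTop {m : ℕ} (T : Triple k n)
    (h : maxContactIdealSheaf T.kHom T.ideal m = ⊤) : MaxContactHypersurface m T where
  ideal := ⊤
  le_maxContactIdealSheaf := h ▸ le_rfl
  exists_generator := fun x hx => by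
    rw [Scheme.IdealSheafData.support_top] at hx
    exact (show False from hx).elim

/-- In dimension `0`, `MC(I) = 𝒟^{m-1}(I) = 𝒪_X` for `m ≥ 1` (it contains `I`, whose stalks are
the unit ideal since the local rings are fields and `I ≠ 0`). [cite: Kollar2007, 3.70 (p. 150)] -/
theorem maxContactIdealSheaf_eq_top_of_dim_zero (T : Triple k 0) (m : ℕ) :
    maxContactIdealSheaf T.kHom T.ideal m = ⊤ := by
  refine top_le_iff.mp ((show (⊤ : T.X.IdealSheafData) ≤ T.ideal from ?_).trans
    (le_derivIdealSheafIter T.kHom (m - 1) T.ideal))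
  refine le_of_forall_stalkIdeal_le fun x => ?_
  have hbot : maximalIdeal (T.X.presheaf.stalk x) = ⊥ :=
    IsLocalRing.isField_iff_maximalIdeal_eq.mp (T.isField_stalk x)
  have htop : stalkIdeal T.ideal x = ⊤ := by
    by_contra hne
    have hle : stalkIdeal T.ideal x ≤ maximalIdeal _ := IsLocalRing.le_maximalIdeal hne
    rw [hbot, le_bot_iff] at hle
    exact T.stalkIdeal_ne_bot x hle
  rw [htop]
  exact le_top

/-- The empty hypersurface of maximal contact on a triple of dimension `0`.
[cite: Kollar2007, 3.70 (p. 150)] -/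
def MaxContactHypersurface.top {m : ℕ} (T : Triple k 0) : MaxContactHypersurface m T :=
  MaxContactHypersurface.ofTop T (maxContactIdealSheaf_eq_top_of_dim_zero T m)

/-- **The hypersurface order reduction functor exists in dimension `0`**: the empty blow-up
sequence (cosupports are empty, `Triple.support_marked_eq_empty`), with all five clauses of
`IsHypersurfaceOrderReduction` (the hypersurfaces "upstairs" being the empty one).
[cite: Kollar2007, 3.70 (p. 150) with 3.104 (pp. 172–173)] -/
theorem exists_isHypersurfaceOrderReduction_zero (m : ℕ) (hm : 1 ≤ m) :
    ∃ B : HypersurfaceFunctor.{u} 0 m, IsHypersurfaceOrderReduction 0 m B := by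
  refine ⟨fun _ _ _ T _ => CentreSeq.nil T.X, ⟨?_, ?_, ?_, ?_, ?_⟩⟩
  · intro k _ _ T H _
    exact ⟨(CentreSeq.isResolutionOf_nil_iff _).mpr (T.support_marked_eq_empty hm), trivial⟩
  · intro k _ _ T H H' _
    rfl
  · intro k _ _ T T' h _ _ _ _ H
    exact ⟨MaxContactHypersurface.top T', fun _ => rfl, rfl⟩
  · intro K _ _ L _ _ σ T T' g _ _ _ H
    exact ⟨MaxContactHypersurface.top T', rfl⟩
  · intro k _ _ T E hE hE' _ _ H
    exact ⟨MaxContactHypersurface.top _, rfl⟩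

end Kollar2007

end Literature.AlgebraicGeometry.Resolution

end
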